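import Mathlib
import Summits.NavierStokesRegularity.NavierStokesRegularity.Theorems.TaoLadderRungTwoFlatCoMovingEnergyDecay
import HarnessLib

/-!
# The co-moving deviation-energy inequality with a TEMPLATE RESIDUAL (junk race L8b-1 for a quasi-exact template)
  (helper for the transfer theorem stmt-NavierStokesRegularity-23909 `GradedAdiabaticWake`; route TaoLadderRungTwoFlat;
  cell harvest/h2-tao-ladder, p1 g21; LADDER §49.3 + HOP-INVARIANT-50 §50.7 (C): the reference `u⋆` is only a
  QUASI-fixed point, hop defect `O(ε₀²)`)

`…CoMovingEnergyCalculus/Rate/Decay` assume the template `W` is an EXACT solution (`u̇ = Q(W+u) − Q(W)`). For child 2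
the template is the persisted quasi-pulse, so the deviation obeys `u̇ᵢ,ₙ = Qᵢ,ₙ(W+u) − Qᵢ,ₙ(W) + rᵢ,ₙ` with a RESIDUAL
`r = −(Ẇ − Q(W))`. The residual adds `Σᵢ uᵢ,ₙ rᵢ,ₙ` to the site-energy balance and `Σ_n φ_n Σᵢ uᵢ,ₙ rᵢ,ₙ ≤ Σ_n φ_n Σᵢ |uᵢ,ₙ||rᵢ,ₙ|`
to `dV/dt`; folding that into the input `Ē` gives the same decay statement:

* `hasDerivAt_deviationEnergy_residual`, `hasDerivAt_coMovingEnergyOn_residual`;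
* `coMovingEnergyOn_decay_Icc_residual` — `V(t₂) ≤ e^{−μ(t₂−t₁)}V(t₁) + Ē(1 − e^{−μ(t₂−t₁)})/μ` where now
  `Ē ≥ (edge input) + Σ_{n∈[a,P]} φ_n Σᵢ |uᵢ,ₙ|·|rᵢ,ₙ|` on `(t₁,t₂)`.

HONEST FRAMING: calculus inequalities about a MODEL lattice (Tao 2016 §4 vocabulary on `S♭`); all bounds are
HYPOTHESES; nothing certified; nothing about the Navier–Stokes equations.
-/

noncomputable section

-- the sub-problem namespace repeats the summit name by design (D-0017)
set_option linter.dupNamespace false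

namespace Summit.NavierStokesRegularity.NavierStokesRegularity.Theorems

open Set Filter Literature.Analysis.FluidPDE Literature.Analysis.FluidPDE.TaoCascade
open scoped Topology

namespace MirrorPulse

/-- **Deviation site energy with residual**: `u̇ᵢ,ₙ = Qᵢ,ₙ(W+u) − Qᵢ,ₙ(W) + rᵢ,ₙ` ⇒
`d/dt ½|u_n|² = (T_{n−1}(u) − T_n(u)) + C_n + Σᵢ uᵢ,ₙ rᵢ,ₙ`. [cite: Tao2016AveragedNS, §4 (4.3), (4.8); route TaoLadderRungTwoFlat, L8b-1 (LADDER §49.3)] -/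
theorem hasDerivAt_deviationEnergy_residual {ε ε₀ : ℝ} {W u r : Fin 2 → ℤ → ℝ → ℝ} {n : ℤ} {t : ℝ}
    (hu : ∀ i, HasDerivAt (u i n) (quadTermOn shiftSetFlat ε₀ (mirrorTable ε ε) (W + u) i n t
        - quadTermOn shiftSetFlat ε₀ (mirrorTable ε ε) W i n t + r i n t) t) :
    HasDerivAt (fun s => (u 0 n s ^ 2 + u 1 n s ^ 2) / 2)
      (((fluxT ε ε₀ u (n - 1) t - fluxT ε ε₀ u n t)
        + ∑ i : Fin 2, u i n t * QuadPolar.linTermOn shiftSetFlat ε₀ (mirrorTable ε ε) W u i n t)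
        + ∑ i : Fin 2, u i n t * r i n t) t := by
  have h := (((hu 0).pow 2).add ((hu 1).pow 2)).div_const 2
  rw [← deviation_site_identity]
  refine h.congr_deriv ?_
  simp only [Fin.sum_univ_two, Fin.isValue, Nat.cast_ofNat, Nat.add_one_sub_one, pow_one]
  ring

/-- **Co-moving block energy with residual**:
`dV_s/dt = −σθ·V_s + Σ_{n∈s} φ_n·((T_{n−1} − T_n) + C_n) + Σ_{n∈s} φ_n·Σᵢ uᵢ,ₙ rᵢ,ₙ`.
[cite: Tao2016AveragedNS, §4 (4.3); route TaoLadderRungTwoFlat, L8b-1 (LADDER §49.3)] -/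
theorem hasDerivAt_coMovingEnergyOn_residual {ε ε₀ θ σ n₀ : ℝ} (s : Finset ℤ) {W u r : Fin 2 → ℤ → ℝ → ℝ} {t : ℝ}
    (hu : ∀ i, ∀ n ∈ s, HasDerivAt (u i n) (quadTermOn shiftSetFlat ε₀ (mirrorTable ε ε) (W + u) i n t
        - quadTermOn shiftSetFlat ε₀ (mirrorTable ε ε) W i n t + r i n t) t) :
    HasDerivAt (fun t' => coMovingEnergyOn s θ (n₀ + σ * t') u t')
      (-(σ * θ) * coMovingEnergyOn s θ (n₀ + σ * t) u t
        + ∑ n ∈ s, Real.exp (θ * ((n : ℝ) - (n₀ + σ * t))) *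
            ((fluxT ε ε₀ u (n - 1) t - fluxT ε ε₀ u n t)
              + ∑ i : Fin 2, u i n t * QuadPolar.linTermOn shiftSetFlat ε₀ (mirrorTable ε ε) W u i n t)
        + ∑ n ∈ s, Real.exp (θ * ((n : ℝ) - (n₀ + σ * t))) * ∑ i : Fin 2, u i n t * r i n t) t := by
  unfold coMovingEnergyOn
  have hterm : ∀ n ∈ s, HasDerivAt
      (fun t' => Real.exp (θ * ((n : ℝ) - (n₀ + σ * t'))) * ((u 0 n t' ^ 2 + u 1 n t' ^ 2) / 2))
      (-(σ * θ) * Real.exp (θ * ((n : ℝ) - (n₀ + σ * t))) * ((u 0 n t ^ 2 + u 1 n t ^ 2) / 2)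
        + Real.exp (θ * ((n : ℝ) - (n₀ + σ * t))) *
          (((fluxT ε ε₀ u (n - 1) t - fluxT ε ε₀ u n t)
            + ∑ i : Fin 2, u i n t * QuadPolar.linTermOn shiftSetFlat ε₀ (mirrorTable ε ε) W u i n t)
            + ∑ i : Fin 2, u i n t * r i n t)) t :=
    fun n hn => (hasDerivAt_comovingWeight θ σ n₀ n t).mul (hasDerivAt_deviationEnergy_residual fun i => hu i n hn)
  have hsum := HasDerivAt.fun_sum hterm
  refine hsum.congr_deriv ?_
  rw [Finset.mul_sum, ← Finset.sum_add_distrib, ← Finset.sum_add_distrib]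
  refine Finset.sum_congr rfl fun n _ => ?_
  ring

/-- The residual coupling is bounded by its absolute form: `Σ_n φ_n Σᵢ uᵢ,ₙ rᵢ,ₙ ≤ Σ_n φ_n Σᵢ |uᵢ,ₙ||rᵢ,ₙ|`.
[cite: Tao2016AveragedNS, §4 (4.3); route TaoLadderRungTwoFlat, L8b-1] -/
theorem residualCoupling_le (s : Finset ℤ) (θ ne : ℝ) (u r : Fin 2 → ℤ → ℝ → ℝ) (t : ℝ) :
    ∑ n ∈ s, Real.exp (θ * ((n : ℝ) - ne)) * ∑ i : Fin 2, u i n t * r i n t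
      ≤ ∑ n ∈ s, Real.exp (θ * ((n : ℝ) - ne)) * ∑ i : Fin 2, |u i n t| * |r i n t| := by
  refine Finset.sum_le_sum fun n _ => mul_le_mul_of_nonneg_left ?_ (Real.exp_pos _).le
  refine Finset.sum_le_sum fun i _ => ?_
  rw [← abs_mul]; exact le_abs_self _

/-- **L8b-1 BETWEEN CROSSINGS, QUASI-EXACT TEMPLATE.** As `coMovingEnergyOn_decay_Icc`, with the deviation solving
`u̇ = Q(W+u) − Q(W) + r` and the input bound `Ē` covering the edge input PLUS the residual coupling
`Σ_{n∈[a,P]} φ_n Σᵢ |uᵢ,ₙ|·|rᵢ,ₙ|`. [cite: Tao2016AveragedNS, §4 (4.3), (4.8), §5–§6; route TaoLadderRungTwoFlat, L8b-1 (LADDER §49.3, §50.7 (C))] -/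
theorem coMovingEnergyOn_decay_Icc_residual {ε ε₀ θ σ n₀ A M cbar μ Ebar t₁ t₂ : ℝ} (hε : 0 ≤ ε)
    (hε₀ : -1 ≤ ε₀) (hθ : 0 ≤ θ) {a P : ℤ} (haP : a ≤ P) (ht : t₁ ≤ t₂) {W u r : Fin 2 → ℤ → ℝ → ℝ}
    (hcont : ∀ i, ∀ n ∈ Finset.Icc a P, ContinuousOn (u i n) (Icc t₁ t₂))
    (hder : ∀ t ∈ Ioo t₁ t₂, ∀ i, ∀ n ∈ Finset.Icc a P,
      HasDerivAt (u i n) (quadTermOn shiftSetFlat ε₀ (mirrorTable ε ε) (W + u) i n t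
        - quadTermOn shiftSetFlat ε₀ (mirrorTable ε ε) W i n t + r i n t) t)
    (hA : ∀ t ∈ Ioo t₁ t₂, ∀ i, ∀ n ∈ Finset.Icc (a - 1) (P + 1), |u i n t| ≤ A)
    (hM : ∀ t ∈ Ioo t₁ t₂, ∀ i, ∀ n ∈ Finset.Icc (a - 1) (P + 1), |W i n t| ≤ M)
    (hc : ∀ n ∈ Finset.Icc (a - 1) P, clock ε₀ n ≤ cbar)
    (hE : ∀ t ∈ Ioo t₁ t₂,
      Real.exp (θ * ((a : ℝ) - (n₀ + σ * t))) * |fluxT ε ε₀ u (a - 1) t|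
        + Real.exp (θ * ((P : ℝ) - (n₀ + σ * t))) * |fluxT ε ε₀ u P t|
        + (1 + ε) * cbar * M * (Real.exp (θ * ((a : ℝ) - (n₀ + σ * t))) * u 1 (a - 1) t ^ 2
            + Real.exp (θ * ((P : ℝ) - (n₀ + σ * t))) * u 0 (P + 1) t ^ 2)
        + ∑ n ∈ Finset.Icc a P, Real.exp (θ * ((n : ℝ) - (n₀ + σ * t))) * ∑ i : Fin 2, |u i n t| * |r i n t|
        ≤ Ebar)
    (hμ : 0 < μ) (hμle : μ ≤ σ * θ - 2 * (1 + ε) * cbar * (A * Real.sinh (θ / 2) + M * (3 + Real.exp θ))) :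
    coMovingEnergyOn (Finset.Icc a P) θ (n₀ + σ * t₂) u t₂
      ≤ Real.exp (-μ * (t₂ - t₁)) * coMovingEnergyOn (Finset.Icc a P) θ (n₀ + σ * t₁) u t₁
        + Ebar * (1 - Real.exp (-μ * (t₂ - t₁))) / μ := by
  refine le_exp_neg_mul_add_of_deriv_le (V := fun t => coMovingEnergyOn (Finset.Icc a P) θ (n₀ + σ * t) u t)
    ht hμ (continuousOn_coMovingEnergyOn (Finset.Icc a P) hcont)
    (fun t ht' => hasDerivAt_coMovingEnergyOn_residual (Finset.Icc a P) (hder t ht')) ?_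
  intro t ht'
  have hsrc := weightedSource_le hε hε₀ hθ haP W u t (n₀ + σ * t) (hA t ht') (hM t ht') hc
  have hres := residualCoupling_le (Finset.Icc a P) θ (n₀ + σ * t) u r t
  have hV0 := coMovingEnergyOn_nonneg (Finset.Icc a P) θ (n₀ + σ * t) u t
  have hEt := hE t ht'
  have hrate : (σ * θ - μ) * coMovingEnergyOn (Finset.Icc a P) θ (n₀ + σ * t) u t
      ≥ 2 * (1 + ε) * cbar * (A * Real.sinh (θ / 2) + M * (3 + Real.exp θ))
          * coMovingEnergyOn (Finset.Icc a P) θ (n₀ + σ * t) u t :=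
    mul_le_mul_of_nonneg_right (by linarith) hV0
  linarith

end MirrorPulse

end Summit.NavierStokesRegularity.NavierStokesRegularity.Theorems

end
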